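/-
HONEST FRAMING: certified error envelopes and provably optimal rounding/accumulation schemes for
low-precision formats under stated cost models; every table by two implementations; no hardware
or vendor claims.
-/
import Summits.Ventures.CertifiedArithmetic.LowPrec.OptDemotionBudgetCert

/-!
# The demotion law (Theorem T8), part 7f(A): kernel certificates for EIGHT summands at (q,p) = (4,2), blocks 0–4

`decide +kernel` evaluations of `budgetCheck 4 2` (part 7c) on the 429 ordered shapes with 8 leaves,
cut into 20 blocks of 22 shapes (`chunk`, part 7d; ≈ 1 minute of kernel time each): parts 7f(A),
7f(B), 7f(C) hold blocks 0–4, 5–9, 10–14; part 7f (`OptDemotionBudgetCert8`) holds blocks 15–19,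
the reassembly `budgetCheck_4_2_eight`, `budgetCheck_4_2_upTo8` (all 626 ordered shapes with at
most 8 leaves) and `conjectureD_4_2_of_le_eight`.
-/

namespace Summit.Ventures.CertifiedArithmetic.LowPrec.Opt

open Literature.ComputerArithmetic.JeannerodRump2018
open Literature.ComputerArithmetic.JeannerodRump2018.SumTree

/-- (4,2), the 429 shapes with 8 leaves, block 0 (shapes 0–21). -/
theorem budgetCheck_4_2_eight_0 : (chunk (shapesN 8) 22 0).all (budgetCheck 4 2) = true := by
  decide +kernel

/-- (4,2), the 429 shapes with 8 leaves, block 1 (shapes 22–43). -/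
theorem budgetCheck_4_2_eight_1 : (chunk (shapesN 8) 22 1).all (budgetCheck 4 2) = true := by
  decide +kernel

/-- (4,2), the 429 shapes with 8 leaves, block 2 (shapes 44–65). -/
theorem budgetCheck_4_2_eight_2 : (chunk (shapesN 8) 22 2).all (budgetCheck 4 2) = true := by
  decide +kernel

/-- (4,2), the 429 shapes with 8 leaves, block 3 (shapes 66–87). -/
theorem budgetCheck_4_2_eight_3 : (chunk (shapesN 8) 22 3).all (budgetCheck 4 2) = true := by
  decide +kernel

/-- (4,2), the 429 shapes with 8 leaves, block 4 (shapes 88–109). -/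
theorem budgetCheck_4_2_eight_4 : (chunk (shapesN 8) 22 4).all (budgetCheck 4 2) = true := by
  decide +kernel

end Summit.Ventures.CertifiedArithmetic.LowPrec.Opt
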